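import Literature.AlgebraicGeometry.Frobenioids.PrimesMonoidIsoRight
import Literature.AlgebraicGeometry.Frobenioids.MonoprimeRigidity
import Literature.AlgebraicGeometry.Frobenioids.Thm49Sub
import HarnessLib

/-!
# [FrdI] Theorem 4.9, sub-DAG row T49-L06 `TwinPrimaryCriterion` — DISCHARGED

Mochizuki, *The geometry of Frobenioids I: the general theory*, Kyushu J. Math. **62** (2008)
293–400, §4, proof of Theorem 4.9, kurims text p. 90 ll. 1–4 [cite: MochizukiFrdI2008, Thm. 4.9 p.90]:
"it suffices to show, for each `𝔭 ∈ Prime(Φ₁(A))`, the existence of twin-primary steps with zero divisor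
in `𝔭` that are mapped by `Ψ` to twin-primary steps of `C₂`" — i.e. such a witness forces the right-hand
and left-hand isomorphisms of Thm. 4.2 (iii) at `(A, 𝔭)` to coincide.

PROOF-ONLY file (seat abc-iut-w4-d105; D-0068 sub-DAG S5 row `FrdI:Thm4.9/T49-L06`, L1 MENU M12):
`FrdI.T49.twinPrimaryCriterion_holds : FrdI.T49.TwinPrimaryCriterion` AS TYPED in `Thm49Sub.lean`
(seat abc-iut-L1-t14). Proof: the right-hand isomorphism `r` (`PreFrobenioid.exists_rightIso`) and the
left-hand isomorphism `l` (`PreFrobenioid.exists_leftIso`) of Thm. 4.2 (iii) exist under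
`FrdI.T42.Setting` and the two prime-correspondence hypotheses; a twin-primary pair `β : A → B`,
`γ : C → A` with `Div β ∈ 𝔭` mapped to a twin-primary pair gives `r(Div β) = Div(Ψβ) = (Ψγ)_*Div(Ψγ)
= l(Div β)`; `Φ₁(A)_𝔭` is monoprime (`Φ₁` perf-factorial), so `r = l`
(`IsMonoprime.mulEquiv_eq_of_apply_eq`, `Div β ≠ 0` as `β` is a step), and `m := r` satisfies both
clauses of `RightEqLeftAt`. No new definitions; nothing of [FrdI] is restated.
-/

namespace Literature.AlgebraicGeometry.Frobenioids

open CategoryTheory Opposite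

namespace FrdI.T49

universe w v v' u u'

set_option backward.isDefEq.respectTransparency false in
/-- **T49-L06 `TwinPrimaryCriterion` holds** ([FrdI] proof of Thm. 4.9, p. 90 ll. 1–4): a twin-primary
pair with zero divisor in `𝔭`, mapped by `Ψ` to a twin-primary pair, forces the right-hand and
left-hand isomorphisms of Thm. 4.2 (iii) at `(A, 𝔭, 𝔭')` to coincide. [cite: MochizukiFrdI2008, Thm. 4.9 p.90] -/
theorem twinPrimaryCriterion_holds : TwinPrimaryCriterion.{w, v, v', u, u'} := by
  intro D₁ _ Φ₁ C₁ _ D₂ _ Φ₂ C₂ _ F₁ F₂ Ψ hS A hA hdivid 𝔭 𝔭' he he' htwin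
  obtain ⟨B, C', β, γ, ⟨hβs, -, hγs, -, hβγ⟩, hβ𝔭, ⟨-, -, -, -, hβγ₂⟩⟩ := htwin
  have hco : ∀ {X Y : C₁} (f : X ⟶ Y), PreFrobenioid.IsCoAngular F₁ f :=
    fun f => PreFrobenioid.isCoAngular_of_isIsotropic_codomains F₁ f fun Z _ => hS.isotropic₁ Z
  -- the right-hand and left-hand isomorphisms of Thm. 4.2 (iii)
  obtain ⟨r, hr⟩ := PreFrobenioid.exists_rightIso Ψ hS.isFrobenioid₁ hS.isFrobenioid₂ hS.isotropic₁
    hS.isotropic₂ hS.perfFactorial₁ hS.perfFactorial₂ hS.preStep_map hS.preStep_inv hS.frobeniusType_map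
    hS.degFr_map hA hdivid 𝔭 𝔭' he
  obtain ⟨l, hl⟩ := PreFrobenioid.exists_leftIso Ψ hS.isFrobenioid₁ hS.isFrobenioid₂ hS.isotropic₁
    hS.isotropic₂ hS.perfFactorial₁ hS.perfFactorial₂ hS.preStep_map hS.preStep_inv hS.frobeniusType_map
    hS.degFr_map hA hdivid 𝔭 𝔭' he'
  -- they agree at `t := Div β ∈ Φ₁(A)_𝔭`, `t ≠ 0`
  have ht : PreFrobenioid.Div F₁ β ∈ 𝔭.submonoid := Submonoid.subset_closure hβ𝔭
  have hγ₂ : PreFrobenioid.IsPreStep F₂ (Ψ.functor.map γ) := hS.preStep_map γ hγs.1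
  haveI : IsIso (PreFrobenioid.Base F₂ (Ψ.functor.map γ)) := hγ₂.2
  have h1 : ((r ⟨PreFrobenioid.Div F₁ β, ht⟩ : 𝔭'.submonoid) :
      Φ₂.obj (op (PreFrobenioid.baseObj F₂ (Ψ.functor.obj A)))) =
        PreFrobenioid.Div F₂ (Ψ.functor.map β) :=
    hr β ⟨hco β, hβs.1⟩ ht
  have h2 : pull Φ₂ (PreFrobenioid.Base F₂ (Ψ.functor.map γ))
      ((l ⟨PreFrobenioid.Div F₁ β, ht⟩ : 𝔭'.submonoid) :
        Φ₂.obj (op (PreFrobenioid.baseObj F₂ (Ψ.functor.obj A)))) =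
        PreFrobenioid.Div F₂ (Ψ.functor.map γ) :=
    hl γ ⟨hco γ, hγs.1⟩ _ ht (by rw [hβγ hγs.1.2, PreFrobenioid.pull_invDiv])
  have h3 : pull Φ₂ (PreFrobenioid.Base F₂ (Ψ.functor.map γ)) (PreFrobenioid.Div F₂ (Ψ.functor.map β)) =
      PreFrobenioid.Div F₂ (Ψ.functor.map γ) := by
    rw [hβγ₂ hγ₂.2, PreFrobenioid.pull_invDiv]
  have hrl : r ⟨PreFrobenioid.Div F₁ β, ht⟩ = l ⟨PreFrobenioid.Div F₁ β, ht⟩ :=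
    Subtype.ext (pull_injective_of_isIso Φ₂ (PreFrobenioid.Base F₂ (Ψ.functor.map γ))
      (by rw [h1, h3, h2]))
  have hne : (⟨PreFrobenioid.Div F₁ β, ht⟩ : 𝔭.submonoid) ≠ 1 := fun h =>
    PreFrobenioid.div_ne_one_of_isStep hS.isotropic₁ hβs (congrArg Subtype.val h)
  -- `Φ₁(A)_𝔭` is monoprime: `r = l`
  have hrl' : r = l :=
    ((hS.perfFactorial₁ (PreFrobenioid.baseObj F₁ A)).isMonoprime 𝔭).mulEquiv_eq_of_apply_eq r l hne hrl
  refine ⟨r, hr, ?_⟩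
  rw [hrl']
  exact hl

end FrdI.T49

end Literature.AlgebraicGeometry.Frobenioids
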